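import Summits.BirchSwinnertonDyer.BirchSwinnertonDyer.Theorems.GenusKolyvaginAtTwoTorsionCellTorsionControl
import HarnessLib

/-!
# LINE 49 «full_vertex» — (T4): no rational point of order `4` on a full-`2`-torsion curve, from non-squares among `eᵢ − eⱼ`

Crux R″ `RankOneTwoTorsionResidualAtTwo` (stmt-BirchSwinnertonDyer-27478) of route GenusKolyvaginAtTwo, LINE 49
«torsion_cell_full_vertex_bsdidea1» (pen bsd-idea-1); companion of `…LevelZeroRigidity` (LEMMA L0 of memo #6 r4 §4bis.7),
whose input (T4) «`E₀(ℚ)` has no point of order `4`» (checked per base by the pen, 18/18) is here reduced, DEF-FREE, to the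
classical square criterion (complete `2`-descent, Silverman AEC X.1.4 / Knapp Thm. 4.2: `Tᵢ ∈ 2E(F)` iff `eᵢ − eⱼ` and
`eᵢ − e_k` are both squares):

* `eq_zero_or_x_eq_of_add_self_eq_zero` — a point `P ∈ E(F)` with `P + P = O` is `O` or has `x(P) ∈ {e₁, e₂, e₃}`;
* `isSquare_and_of_twoTorsion_mem_two` — if `(eᵢ, ·) = Q + Q` then `eᵢ − eⱼ` and `eᵢ − e_k` are squares in `F`;
* **`two_nsmul_eq_zero_of_four_nsmul_eq_zero`** — (T4): if for each `i` NOT both `eᵢ − eⱼ`, `eᵢ − e_k` are squares, then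
  `4 • Q = O ⟹ 2 • Q = O` for every `Q ∈ E(F)` — the hypothesis `hT4` of `…LevelZero.smul_eq_neg_of_half(_cell)`.

Everything is proved (no `sorry`, standard axioms); nothing here is a statement of the line, and NOTHING HERE PROVES R″ or any
summit — BSD is not advanced by this file alone.

## References

* [SilvermanAEC2009] J. H. Silverman, *The Arithmetic of Elliptic Curves*, 2nd ed. (2009), Prop. X.1.4.
* [Knapp1993] A. W. Knapp, *Elliptic Curves* (1993), Thm. 4.2 (the halving criterion).
-/

open WeierstrassCurve WeierstrassCurve.Affine
open WeierstrassCurve.Affine.Point hiding some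
open scoped Classical

noncomputable section

namespace Summit.BirchSwinnertonDyer.BirchSwinnertonDyer.Theorems.GenusKolyvaginAtTwo.FullVertex.LevelZero

variable {F : Type*} [Field F] [CharZero F] {W : WeierstrassCurve F} [W.IsElliptic] {e₁ e₂ e₃ : F}

omit [W.IsElliptic] in
/-- **`E(F)[2] = {O, T₁, T₂, T₃}`**: a point `P` with `P + P = O` is `O` or an affine point with `x(P) ∈ {e₁, e₂, e₃}`
(`2y + a₁x + a₃ = 0`, so `x` is a root of the `2`-division cubic `∏ (x − eᵢ)`). [cite: SilvermanAEC2009, Prop. X.1.4] -/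
theorem eq_zero_or_x_eq_of_add_self_eq_zero (h : W.toAffine.SplitTwoTorsion e₁ e₂ e₃) (P : W.toAffine.Point)
    (hP : P + P = 0) :
    P = 0 ∨ ∃ (x y : F) (hxy : W.toAffine.Nonsingular x y), P = Point.some x y hxy ∧ (x = e₁ ∨ x = e₂ ∨ x = e₃) := by
  rcases P with _ | ⟨x, y, hxy⟩
  · exact Or.inl rfl
  · refine Or.inr ⟨x, y, hxy, rfl, ?_⟩
    have hneg : y = W.toAffine.negY x y := by
      by_contra hy
      rw [add_self_of_Y_ne hy] at hP
      exact some_ne_zero _ hP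
    have hy0 : y + (W.toAffine.a₁ * x + W.toAffine.a₃) / 2 = 0 := by
      rw [negY] at hneg
      linear_combination (1 / 2 : F) * hneg
    have hcubic := sq_eq_mul_mul_of_equation h hxy.1
    rw [hy0, zero_pow two_ne_zero, eq_comm, mul_eq_zero, mul_eq_zero, sub_eq_zero, sub_eq_zero,
      sub_eq_zero] at hcubic
    rcases hcubic with (hx | hx) | hx
    · exact Or.inl hx
    · exact Or.inr (Or.inl hx)
    · exact Or.inr (Or.inr hx)

/-- **A halvable `2`-torsion point forces two squares**: if `P = (e₁, ·) = Q + Q` in `E(F)` then `e₁ − e₂` and `e₁ − e₃` are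
squares in `F` (both Kummer components of `P` are trivial: `(e₁−e₂)(e₁−e₃) ∈ F²` at `T₁` and `e₁ − e₂ ∈ F²` at `T₂`).
[cite: SilvermanAEC2009, Prop. X.1.4] [cite: Knapp1993, Thm. 4.2] -/
theorem isSquare_and_of_twoTorsion_mem_two (h : W.toAffine.SplitTwoTorsion e₁ e₂ e₃) {x y : F}
    (hxy : W.toAffine.Nonsingular x y) (hx : x = e₁) (Q : W.toAffine.Point) (hQ : Q + Q = Point.some x y hxy) :
    (∃ u : F, e₁ - e₂ = u ^ 2) ∧ ∃ u : F, e₁ - e₃ = u ^ 2 := by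
  -- component at `T₁`: `(e₁ − e₂)(e₁ − e₃)` is a square
  have h1 : twoDescentComponent W.toAffine e₁ e₂ e₃ (Point.some x y hxy) = 1 := by
    rw [← hQ, twoDescentComponent_add h, SqUnits.mul_self]
  rw [twoDescentComponent_some_of_eq hxy hx, sqClass_eq_one_iff h.c_ne_zero] at h1
  -- component at `T₂`: `x − e₂ = e₁ − e₂` is a square
  have hne : x ≠ e₂ := by rw [hx]; exact h.ne₁₂
  have h2 : twoDescentComponent W.toAffine e₂ e₁ e₃ (Point.some x y hxy) = 1 := by
    rw [← hQ, twoDescentComponent_add h.swap₁₂, SqUnits.mul_self]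
  rw [twoDescentComponent_some_of_ne hxy hne, hx, sqClass_eq_one_iff (sub_ne_zero.mpr h.ne₁₂)] at h2
  obtain ⟨w, hw⟩ := h1
  obtain ⟨v, hv⟩ := h2
  refine ⟨⟨v, hv⟩, ⟨w / v, ?_⟩⟩
  have hv0 : v ≠ 0 := by
    rintro rfl
    exact sub_ne_zero.mpr h.ne₁₂ (by rw [hv]; ring)
  rw [div_pow, eq_div_iff (pow_ne_zero 2 hv0)]
  linear_combination hw - (e₁ - e₃) * hv

/-- **(T4) from non-squares.**  If for each `i` it is NOT the case that both `eᵢ − eⱼ` and `eᵢ − e_k` are squares in `F`,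
then `E(F)` has no point of order `4`: `4 • Q = O ⟹ 2 • Q = O`.  (The hypothesis `hT4` of
`…LevelZero.smul_eq_neg_of_half` / `_cell`; for an integral base `eᵢ ∈ ℤ` it is a finite check.)
[cite: SilvermanAEC2009, Prop. X.1.4] [cite: Knapp1993, Thm. 4.2] -/
theorem two_nsmul_eq_zero_of_four_nsmul_eq_zero (h : W.toAffine.SplitTwoTorsion e₁ e₂ e₃)
    (h₁ : ¬ ((∃ u : F, e₁ - e₂ = u ^ 2) ∧ ∃ u : F, e₁ - e₃ = u ^ 2))
    (h₂ : ¬ ((∃ u : F, e₂ - e₁ = u ^ 2) ∧ ∃ u : F, e₂ - e₃ = u ^ 2))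
    (h₃ : ¬ ((∃ u : F, e₃ - e₁ = u ^ 2) ∧ ∃ u : F, e₃ - e₂ = u ^ 2))
    (Q : W.toAffine.Point) (hQ : (4 : ℕ) • Q = 0) : (2 : ℕ) • Q = 0 := by
  have hP : (2 : ℕ) • Q + (2 : ℕ) • Q = 0 := by
    rw [← two_nsmul, ← mul_smul]; exact hQ
  rcases eq_zero_or_x_eq_of_add_self_eq_zero h _ hP with h0 | ⟨x, y, hxy, hPxy, hx | hx | hx⟩
  · exact h0
  · exact absurd (isSquare_and_of_twoTorsion_mem_two h hxy hx Q (by rw [← hPxy, two_nsmul])) h₁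
  · exact absurd (isSquare_and_of_twoTorsion_mem_two h.swap₁₂ hxy hx Q (by rw [← hPxy, two_nsmul])) h₂
  · exact absurd (isSquare_and_of_twoTorsion_mem_two h.swap₂₃.swap₁₂ hxy hx Q (by rw [← hPxy, two_nsmul]))
      (fun hh => h₃ ⟨hh.1, hh.2⟩)

end Summit.BirchSwinnertonDyer.BirchSwinnertonDyer.Theorems.GenusKolyvaginAtTwo.FullVertex.LevelZero

end
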